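import Mathlib
import Summits.KontsevichZagierPeriods.KontsevichZagierPeriods.Theorems.SoloInformedNashCharts
import Literature.NumberTheory.Transcendental.CurvePeriodsPathApproxProofs
import Literature.NumberTheory.Transcendental.CurvePeriodsPathCalculusProofs
import Literature.NumberTheory.Transcendental.KZCalculusProofs
import HarnessLib

/-!
# SoloInformed — Nash pieces: `C¹` semialgebraic chordal pieces in a chart

File H1 of the Nash-replacement construction (APPROX) of `paper/rung2-v2.md` §4.4.
The step reparametrisation `σ_{N,r}(t) = φ(N · clamp_{[r/N,(r+1)/N]}(t) − r)` with the cubic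
`φ(u) = 3u² − 2u³` is `C¹` on `[−1, 2]` (the cubic has vanishing derivative at `0` and `1`;
`C¹` gluing `contDiffOn_Icc_of_derivWithin_eq`), piecewise polynomial hence `ℚ`-semialgebraic,
`= 0` left of `r/N` and `= 1` right of `(r+1)/N`. In a local chart `ψ` (graph property) of a smooth
affine `ℚ̄`-curve, the *chordal piece* `t ↦ ψ(segPoint a b (σ_{N,r} t))` between two parameters
`a, b` of the chart disc is `C¹` on `[−1, 2]`, lies on the curve, and — when `a, b` are algebraic —
has `ℚ`-semialgebraic real and imaginary parts on `(−1, 2)` by the chart lemma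
(`soloInformed_reImSA_chart`) applied with a Gaussian-rational window around the compact image of
the chord. References: Bochnak–Coste–Roy 1998, §2.2, §8.1; Huber–Wüstholz 2022, §3.3.1.
-/

noncomputable section

open Set MvPolynomial Metric
open Literature.NumberTheory.Transcendental Literature.NumberTheory.Transcendental.KZ
open Literature.NumberTheory.Transcendental.CurvePeriods
open Literature.ModelTheory.ExponentialFields (IsSemialgebraic isSemialgebraic_setOf_eval_lt
  isSemialgebraic_setOf_eval_le)

namespace Summit.KontsevichZagierPeriods.KontsevichZagierPeriods.Theorems

/-! ### The step reparametrisation -/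

/-- `σ_{N,r}(t) = φ(N · clamp_{[r/N,(r+1)/N]}(t) − r)` with the cubic smooth step `φ`. -/
def soloInformedStep (N r : ℕ) (t : ℝ) : ℝ := smoothStep ((N : ℝ) * clampPiece N r t - r)

variable {N r : ℕ}

/-- Left of the piece the step is `0`. -/
theorem soloInformedStep_of_le (hN : 0 < N) {t : ℝ} (ht : t ≤ (r : ℝ) / N) :
    soloInformedStep N r t = 0 := by
  have hN' : (N : ℝ) ≠ 0 := by exact_mod_cast hN.ne'
  unfold soloInformedStep
  rw [clampPiece_of_le ht, mul_div_cancel₀ _ hN', sub_self, smoothStep_zero]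

/-- Right of the piece the step is `1`. -/
theorem soloInformedStep_of_ge (hN : 0 < N) {t : ℝ} (ht : ((r : ℝ) + 1) / N ≤ t) :
    soloInformedStep N r t = 1 := by
  have hN' : (N : ℝ) ≠ 0 := by exact_mod_cast hN.ne'
  unfold soloInformedStep
  rw [clampPiece_of_ge ht, mul_div_cancel₀ _ hN', add_sub_cancel_left, smoothStep_one]

/-- On the piece the step is the cubic in `N t − r`. -/
theorem soloInformedStep_of_mem {t : ℝ} (ht : t ∈ Icc ((r : ℝ) / N) (((r : ℝ) + 1) / N)) :
    soloInformedStep N r t = smoothStep ((N : ℝ) * t - r) := by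
  unfold soloInformedStep
  rw [clampPiece_of_mem ht]

/-- The step takes values in `[0, 1]`. -/
theorem soloInformedStep_mem (hN : 0 < N) (t : ℝ) : soloInformedStep N r t ∈ Icc (0 : ℝ) 1 := by
  have hN' : (0 : ℝ) < N := by exact_mod_cast hN
  have hc := clampPiece_mem (N := N) (r := r) t
  refine mapsTo_smoothStep ⟨?_, ?_⟩
  · have h := mul_le_mul_of_nonneg_left hc.1 hN'.le
    rw [mul_div_cancel₀ _ hN'.ne'] at h
    linarith
  · have h := mul_le_mul_of_nonneg_left hc.2 hN'.le
    rw [mul_div_cancel₀ _ hN'.ne'] at h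
    linarith

/-- The step is continuous. -/
theorem continuous_soloInformedStep : Continuous (soloInformedStep N r) :=
  contDiff_smoothStep (n := 0).continuous.comp
    ((continuous_const.mul continuous_clampPiece).sub continuous_const)

/-- The derivative of `t ↦ φ(N t − r)`. -/
theorem soloInformed_hasDerivAt_cubic (t : ℝ) :
    HasDerivAt (fun t : ℝ => smoothStep ((N : ℝ) * t - r))
      (6 * ((N : ℝ) * t - r) * (1 - ((N : ℝ) * t - r)) * N) t := by
  have hg : HasDerivAt (fun x : ℝ => (N : ℝ) * x - r) ((N : ℝ) * 1) t :=
    ((hasDerivAt_id' t).const_mul (N : ℝ)).sub_const (r : ℝ)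
  have h := (hasDerivAt_smoothStep ((N : ℝ) * t - r)).comp t hg
  have h' : HasDerivAt (fun t : ℝ => smoothStep ((N : ℝ) * t - r))
      (6 * ((N : ℝ) * t - r) * (1 - ((N : ℝ) * t - r)) * ((N : ℝ) * 1)) t := h
  exact h'.congr_deriv (by ring)

/-- **The step is `C¹` on `[−1, 2]`** (for `r < N`). [folklore] -/
theorem soloInformed_contDiffOn_step (hr : r < N) :
    ContDiffOn ℝ 1 (soloInformedStep N r) (Icc (-1) 2) := by
  have hN : 0 < N := lt_of_le_of_lt (Nat.zero_le r) hr
  have hN' : (0 : ℝ) < N := by exact_mod_cast hN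
  have hNne : (N : ℝ) ≠ 0 := hN'.ne'
  set a : ℝ := (r : ℝ) / N with ha_def
  set b : ℝ := ((r : ℝ) + 1) / N with hb_def
  have ha : (-1 : ℝ) < a := lt_of_lt_of_le (by norm_num) (div_nonneg (Nat.cast_nonneg r) hN'.le)
  have hab : a < b := div_lt_div_of_pos_right (by linarith) hN'
  have hb1 : b ≤ 1 := by
    rw [hb_def, div_le_one hN']
    exact_mod_cast Nat.succ_le_of_lt hr
  have hb2 : b < 2 := by linarith
  have hNa : (N : ℝ) * a - r = 0 := by rw [ha_def, mul_div_cancel₀ _ hNne, sub_self]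
  have hNb : (N : ℝ) * b - r = 1 := by rw [hb_def, mul_div_cancel₀ _ hNne, add_sub_cancel_left]
  have hmid : ContDiff ℝ 1 (fun t : ℝ => smoothStep ((N : ℝ) * t - r)) :=
    (contDiff_smoothStep (n := 1)).comp ((contDiff_const.mul contDiff_id).sub contDiff_const)
  have h1 : ContDiffOn ℝ 1 (soloInformedStep N r) (Icc (-1) a) :=
    contDiffOn_const.congr fun t ht => soloInformedStep_of_le hN ht.2
  have h2 : ContDiffOn ℝ 1 (soloInformedStep N r) (Icc a b) :=
    hmid.contDiffOn.congr fun t ht => soloInformedStep_of_mem ht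
  have h3 : ContDiffOn ℝ 1 (soloInformedStep N r) (Icc b 2) :=
    contDiffOn_const.congr fun t ht => soloInformedStep_of_ge hN ht.1
  -- one-sided derivatives at `a` and `b` all vanish
  have hd1 : derivWithin (soloInformedStep N r) (Icc (-1) a) a = 0 :=
    ((hasDerivWithinAt_const a (Icc (-1) a) (0 : ℝ)).congr
      (fun t ht => soloInformedStep_of_le hN ht.2) (soloInformedStep_of_le hN le_rfl)).derivWithin
      (uniqueDiffOn_Icc ha a ⟨ha.le, le_rfl⟩)
  have hd2a : derivWithin (soloInformedStep N r) (Icc a b) a = 0 := by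
    rw [((soloInformed_hasDerivAt_cubic (N := N) (r := r) a).hasDerivWithinAt.congr
      (fun t ht => soloInformedStep_of_mem ht)
      (soloInformedStep_of_mem ⟨le_rfl, hab.le⟩)).derivWithin
      (uniqueDiffOn_Icc hab a ⟨le_rfl, hab.le⟩), hNa]
    ring
  have hd2b : derivWithin (soloInformedStep N r) (Icc a b) b = 0 := by
    rw [((soloInformed_hasDerivAt_cubic (N := N) (r := r) b).hasDerivWithinAt.congr
      (fun t ht => soloInformedStep_of_mem ht)
      (soloInformedStep_of_mem ⟨hab.le, le_rfl⟩)).derivWithin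
      (uniqueDiffOn_Icc hab b ⟨hab.le, le_rfl⟩), hNb]
    ring
  have hd3 : derivWithin (soloInformedStep N r) (Icc b 2) b = 0 :=
    ((hasDerivWithinAt_const b (Icc b 2) (1 : ℝ)).congr
      (fun t ht => soloInformedStep_of_ge hN ht.1) (soloInformedStep_of_ge hN le_rfl)).derivWithin
      (uniqueDiffOn_Icc hb2 b ⟨le_rfl, hb2.le⟩)
  have h12 : ContDiffOn ℝ 1 (soloInformedStep N r) (Icc (-1) b) :=
    contDiffOn_Icc_of_derivWithin_eq ha hab h1 h2 (by rw [hd1, hd2a])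
  have hd12 : derivWithin (soloInformedStep N r) (Icc (-1) b) b = 0 := by
    rw [← derivWithin_congr_set (Icc_eventuallyEq_Icc_of_gt ha.le hab), hd2b]
  exact contDiffOn_Icc_of_derivWithin_eq (by linarith) hb2 h12 h3 (by rw [hd12, hd3])

/-- **The step is `ℚ`-semialgebraic** (piecewise polynomial with rational break points).
[BCR 1998, §2.2] -/
theorem soloInformed_isSemialgebraicFunOn_step (hN : 0 < N) {s : Set (Fin 1 → ℝ)}
    (hs : IsSemialgebraic ℚ s) :
    IsSemialgebraicFunOn ℚ s (fun x => soloInformedStep N r (x 0)) := by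
  have hN' : (0 : ℝ) < N := by exact_mod_cast hN
  -- the three pieces of `s`
  have hA : IsSemialgebraic ℚ {x : Fin 1 → ℝ | x 0 ≤ (r : ℝ) / N} := by
    have h := isSemialgebraic_setOf_eval_le (k := ℚ) (R := ℝ)
      (X 0 : MvPolynomial (Fin 1) ℚ) (C ((r : ℚ) / N))
    simp only [MvPolynomial.aeval_X, MvPolynomial.aeval_C, eq_ratCast, Rat.cast_div,
      Rat.cast_natCast] at h
    exact h
  have hB : IsSemialgebraic ℚ {x : Fin 1 → ℝ | (r : ℝ) / N ≤ x 0} := by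
    have h := isSemialgebraic_setOf_eval_le (k := ℚ) (R := ℝ)
      (C ((r : ℚ) / N) : MvPolynomial (Fin 1) ℚ) (X 0)
    simp only [MvPolynomial.aeval_X, MvPolynomial.aeval_C, eq_ratCast, Rat.cast_div,
      Rat.cast_natCast] at h
    exact h
  have hC : IsSemialgebraic ℚ {x : Fin 1 → ℝ | x 0 ≤ ((r : ℝ) + 1) / N} := by
    have h := isSemialgebraic_setOf_eval_le (k := ℚ) (R := ℝ)
      (X 0 : MvPolynomial (Fin 1) ℚ) (C (((r : ℚ) + 1) / N))
    simp only [MvPolynomial.aeval_X, MvPolynomial.aeval_C, eq_ratCast, Rat.cast_div,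
      Rat.cast_natCast, Rat.cast_add, Rat.cast_one] at h
    exact h
  have hD : IsSemialgebraic ℚ {x : Fin 1 → ℝ | ((r : ℝ) + 1) / N ≤ x 0} := by
    have h := isSemialgebraic_setOf_eval_le (k := ℚ) (R := ℝ)
      (C (((r : ℚ) + 1) / N) : MvPolynomial (Fin 1) ℚ) (X 0)
    simp only [MvPolynomial.aeval_X, MvPolynomial.aeval_C, eq_ratCast, Rat.cast_div,
      Rat.cast_natCast, Rat.cast_add, Rat.cast_one] at h
    exact h
  have h1 : IsSemialgebraicFunOn ℚ (s ∩ {x | x 0 ≤ (r : ℝ) / N})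
      (fun x => soloInformedStep N r (x 0)) :=
    (isSemialgebraicFunOn_const_of_isAlgebraic (hs.inter hA) isAlgebraic_zero).congr
      fun x hx => (soloInformedStep_of_le hN hx.2).symm
  have h2 : IsSemialgebraicFunOn ℚ (s ∩ {x | (r : ℝ) / N ≤ x 0} ∩ {x | x 0 ≤ ((r : ℝ) + 1) / N})
      (fun x => soloInformedStep N r (x 0)) := by
    let P : MvPolynomial (Fin 1) ℚ :=
      (C (N : ℚ) * X 0 - C (r : ℚ)) * (C (N : ℚ) * X 0 - C (r : ℚ)) *
        (C 3 - C 2 * (C (N : ℚ) * X 0 - C (r : ℚ)))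
    refine (isSemialgebraicFunOn_aeval ((hs.inter hB).inter hC) P).congr fun x hx => ?_
    rw [soloInformedStep_of_mem ⟨hx.1.2, hx.2⟩]
    simp [P, smoothStep]
  have h3 : IsSemialgebraicFunOn ℚ (s ∩ {x | ((r : ℝ) + 1) / N ≤ x 0})
      (fun x => soloInformedStep N r (x 0)) :=
    (isSemialgebraicFunOn_const_of_isAlgebraic (hs.inter hD) isAlgebraic_one).congr
      fun x hx => (soloInformedStep_of_ge hN hx.2).symm
  have h := (h1.union h2 (fun _ _ => rfl) (fun _ _ => rfl)).union h3 (fun _ _ => rfl)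
    (fun _ _ => rfl)
  refine h.mono (fun x hx => ?_) hs
  rcases le_total (x 0) ((r : ℝ) / N) with hl | hl
  · exact Or.inl (Or.inl ⟨hx, hl⟩)
  · rcases le_total (x 0) (((r : ℝ) + 1) / N) with hm | hm
    · exact Or.inl (Or.inr ⟨⟨hx, hl⟩, hm⟩)
    · exact Or.inr ⟨hx, hm⟩

/-- The step, as a complex-valued function, has `ℚ`-semialgebraic real and imaginary parts. -/
theorem soloInformed_reImSA_step (hN : 0 < N) {s : Set (Fin 1 → ℝ)} (hs : IsSemialgebraic ℚ s) :
    SoloInformedReImSA s (fun x => (soloInformedStep N r (x 0) : ℂ)) :=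
  ⟨(soloInformed_isSemialgebraicFunOn_step hN hs).congr fun _ _ => (Complex.ofReal_re _).symm,
    (isSemialgebraicFunOn_const_of_isAlgebraic hs isAlgebraic_zero).congr
      fun _ _ => (Complex.ofReal_im _).symm⟩

/-- `segPoint a b ∘ σ` has `ℚ`-semialgebraic real and imaginary parts for algebraic `a, b` and a
`ℚ`-semialgebraic real `σ`. [BCR 1998, §2.2] -/
theorem soloInformed_reImSA_segPoint {m : ℕ} {s : Set (Fin m → ℝ)} (hs : IsSemialgebraic ℚ s)
    {a b : ℂ} (ha : IsAlgebraic ℚ a) (hb : IsAlgebraic ℚ b) {σ : (Fin m → ℝ) → ℝ}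
    (hσ : SoloInformedReImSA s (fun x => (σ x : ℂ))) :
    SoloInformedReImSA s (fun x => segPoint a b (σ x)) := by
  have h := (((SoloInformedReImSA.const hs isAlgebraic_one).add
    (hσ.mul (SoloInformedReImSA.const hs (isAlgebraic_one.neg : IsAlgebraic ℚ (-1 : ℂ))))).mul
    (SoloInformedReImSA.const hs ha)).add (hσ.mul (SoloInformedReImSA.const hs hb))
  refine h.congr fun x _ => ?_
  simp only [segPoint, Complex.ofReal_sub, Complex.ofReal_one]
  ring

/-! ### Chordal pieces in a chart -/

section Piece

variable {Z : CurveData} {i₀ : Fin Z.n} {w₀ : ℂ} {ε : ℝ} {Ω : Set (Fin Z.n → ℂ)}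
  {ψ : ℂ → Fin Z.n → ℂ} {a b : ℂ}

/-- The chordal piece `t ↦ ψ(segPoint a b (σ_{N,r} t))` of a chart `ψ`. -/
def soloInformedChartPiece (ψ : ℂ → Fin Z.n → ℂ) (a b : ℂ) (N r : ℕ) (t : ℝ) : Fin Z.n → ℂ :=
  ψ (segPoint a b (soloInformedStep N r t))

/-- Left of the piece the chordal piece sits at `ψ a`. -/
theorem soloInformedChartPiece_of_le (hN : 0 < N) {t : ℝ} (ht : t ≤ (r : ℝ) / N) :
    soloInformedChartPiece ψ a b N r t = ψ a := by
  simp [soloInformedChartPiece, soloInformedStep_of_le hN ht]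

/-- Right of the piece the chordal piece sits at `ψ b`. -/
theorem soloInformedChartPiece_of_ge (hN : 0 < N) {t : ℝ} (ht : ((r : ℝ) + 1) / N ≤ t) :
    soloInformedChartPiece ψ a b N r t = ψ b := by
  simp [soloInformedChartPiece, soloInformedStep_of_ge hN ht]

/-- The chord parameter stays in the chart disc. -/
theorem soloInformed_segPoint_step_mem (hN : 0 < N) (ha : a ∈ ball w₀ ε) (hb : b ∈ ball w₀ ε)
    (t : ℝ) : segPoint a b (soloInformedStep N r t) ∈ ball w₀ ε :=
  segPoint_mem (convex_ball w₀ ε) ha hb (soloInformedStep_mem hN t)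

/-- The chordal piece lies in `Ω ∩ Z(ℂ)`. -/
theorem soloInformedChartPiece_mem (hN : 0 < N)
    (h2 : ∀ w ∈ ball w₀ ε, ψ w ∈ Ω ∧ ψ w ∈ Z.points ∧ ψ w i₀ = w)
    (ha : a ∈ ball w₀ ε) (hb : b ∈ ball w₀ ε) (t : ℝ) :
    soloInformedChartPiece ψ a b N r t ∈ Ω ∧ soloInformedChartPiece ψ a b N r t ∈ Z.points :=
  let h := h2 _ (soloInformed_segPoint_step_mem (r := r) hN ha hb t)
  ⟨h.1, h.2.1⟩

/-- The chordal piece is continuous. -/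
theorem continuous_soloInformedChartPiece (hN : 0 < N) (hψ : ContinuousOn ψ (ball w₀ ε))
    (ha : a ∈ ball w₀ ε) (hb : b ∈ ball w₀ ε) :
    Continuous (soloInformedChartPiece ψ a b N r) :=
  hψ.comp_continuous ((contDiff_segPoint a b (n := 0)).continuous.comp continuous_soloInformedStep)
    fun t => soloInformed_segPoint_step_mem hN ha hb t

/-- **The chordal piece is `C¹` on `[−1, 2]`.** [folklore] -/
theorem soloInformed_contDiffOn_chartPiece (hr : r < N) (hψ : AnalyticOnNhd ℂ ψ (ball w₀ ε))
    (ha : a ∈ ball w₀ ε) (hb : b ∈ ball w₀ ε) :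
    ContDiffOn ℝ 1 (soloInformedChartPiece ψ a b N r) (Icc (-1) 2) := by
  have hN : 0 < N := lt_of_le_of_lt (Nat.zero_le r) hr
  have hψ' : ContDiffOn ℝ 1 ψ (ball w₀ ε) :=
    (hψ.contDiffOn_of_completeSpace (n := 1)).restrict_scalars ℝ
  refine hψ'.comp ((contDiff_segPoint a b (n := 1)).comp_contDiffOn
    (soloInformed_contDiffOn_step hr)) fun t _ => ?_
  exact soloInformed_segPoint_step_mem hN ha hb t

/-- **The chordal piece is Nash**: for algebraic chord parameters its coordinates have
`ℚ`-semialgebraic real and imaginary parts on `(−1, 2)`. [BCR 1998, Prop. 8.1.8;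
Huber–Wüstholz 2022, §3.3.1] -/
theorem soloInformed_reImSA_chartPiece (hN : 0 < N) (hF : ∀ j, HasAlgCoeffs (Z.F j))
    (hΩ : IsOpen Ω) (hψ : ContinuousOn ψ (ball w₀ ε))
    (h1 : ∀ z ∈ Ω, z ∈ Z.points → z i₀ ∈ ball w₀ ε ∧ ψ (z i₀) = z)
    (h2 : ∀ w ∈ ball w₀ ε, ψ w ∈ Ω ∧ ψ w ∈ Z.points ∧ ψ w i₀ = w)
    (ha : a ∈ ball w₀ ε) (hb : b ∈ ball w₀ ε) (haa : IsAlgebraic ℚ a) (hba : IsAlgebraic ℚ b)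
    (j : Fin Z.n) :
    SoloInformedReImSA (soloInformedIoo1 (-1) 2)
      (fun x => soloInformedChartPiece ψ a b N r (x 0) j) := by
  -- a window around the compact image of the chord
  have hK : IsCompact ((fun t : ℝ => ψ (segPoint a b t)) '' Icc 0 1) := by
    refine (isCompact_Icc.image_of_continuousOn (hψ.comp
      (contDiff_segPoint a b (n := 0)).continuous.continuousOn fun t ht => ?_))
    exact segPoint_mem (convex_ball w₀ ε) ha hb ht
  have hKΩ : (fun t : ℝ => ψ (segPoint a b t)) '' Icc 0 1 ⊆ Ω := by
    rintro _ ⟨t, ht, rfl⟩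
    exact (h2 _ (segPoint_mem (convex_ball w₀ ε) ha hb ht)).1
  obtain ⟨W, hKW, hWΩ, hW⟩ := soloInformed_exists_window hK hΩ hKΩ
  have hs : IsSemialgebraic ℚ (soloInformedIoo1 (-1) 2) := by
    simpa using isSemialgebraic_soloInformedIoo1 (-1) 2
  have hc : SoloInformedReImSA (soloInformedIoo1 (-1) 2)
      (fun x => segPoint a b (soloInformedStep N r (x 0))) :=
    soloInformed_reImSA_segPoint hs haa hba (soloInformed_reImSA_step hN hs)
  exact soloInformed_reImSA_chart h1 h2 hWΩ
    (fun x _ => soloInformed_segPoint_step_mem hN ha hb (x 0))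
    (fun x _ => hKW ⟨_, soloInformedStep_mem hN (x 0), rfl⟩) hF hW hs hc j

end Piece

end Summit.KontsevichZagierPeriods.KontsevichZagierPeriods.Theorems
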